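import Summits.Ventures.CertifiedArithmetic.LowPrec.DoubleRoundingProductWindowConverse
import Summits.Ventures.CertifiedArithmetic.LowPrec.DoubleRoundingProductWindow

/-!
# Double rounding of products: the gap DECIDED, and the uniform law in the exponent distance

HONEST FRAMING (venture CertifiedArithmetic / cell `pub-lowprec`): certified error envelopes and
provably optimal rounding/accumulation schemes for low-precision formats under stated cost models;
every table by two implementations; no hardware or vendor claims.

`DRMul φ ψ` (one product of `φ`-data formed in the register `ψ ⊇ φ`, rounded to nearest-even
twice) for a register of precision `P_ψ ≥ 2P` (`P = P_φ = m + 1`) is a property of the exponent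
distance `d = L_φ - L_ψ ≥ 1` (`L = qexp`, the exponent of the least subnormal) alone, for every
DEEP (`bias_φ ≥ m + 3`, i.e. `2^-(2m+2) ∈ F_φ`) and ROOMY (`(2 - 2^-m)/8 ≤ maxRat φ`) embedded pair:

* `d ≥ 2P`            : innocuous — clause (U) of THEOREM D-dm (`DoubleRoundingProduct.lean`);
* `P + 1 ≤ d ≤ 2P - 1` (the GAP, `t = 2P - d`): innocuous iff `mulWindowHit P t = false`
  (§2, `drMul_iff_mulWindowHit`: the window law `DoubleRoundingProductWindow.lean` is sound (§1:
  every hit of the table is a slip, at `j = c`, `α = 0`, `β = bias + m - 1 - d - u`) and complete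
  (`DoubleRoundingProductWindowConverse.lean`: every slip is a hit));
* `1 ≤ d ≤ P`         : never innocuous — THEOREM N-mul-U (`DoubleRoundingProductUnderflow.lean`).

§3 packages the three regimes as one boolean `mulLawTest φ ψ` with
`DRMul φ ψ ↔ mulLawTest φ ψ = true` under the boolean hypothesis `mulLawHyp φ ψ` (§3), so that
cells are decided by evaluating a `t·4^(P-1)`-entry integer table instead of `|F_φ|²` products:
§4 re-derives the exhaustive instances `window_P2/P3/P4` from the law, decides pseudo-record cells
beyond exhaustion (`P = 7`: innocuous already at `d = 11 = 2P - 3`; `P = 8`, the bfloat16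
precision: innocuous at `d = 15`, not at `d = 14`), and evaluates the named `13 × 13` matrix (all
`20` decidable named pairs sit in clause (U)).  By `mulWindowHit_profile` / `mulGapThreshold_table`
(`DoubleRoundingProductGapTable.lean`) the least innocuous distance `d*(P) = 2P - t*(P) + 1` is
`4, 4, 7, 10, 11, 11, 15` quanta-binades for `P = 2, …, 8` (classical sufficient value `2P`:
`4, 6, 8, 10, 12, 14, 16`).

Two implementations: A = `code/enum/mul_window_law.py` (exact rationals: brute force of `DRMul`
on all deep roomy embedded pseudo-record pairs `2 ≤ P ≤ 6`, `P_ψ ∈ {2P, 2P+1}`, `1 ≤ d ≤ 2P + 1`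
against `mulLawTest`, `0` mismatches; every slip a window hit with `u ≤ t`) →
`certs/enum/DOUBLE-ROUNDING-MUL-WINDOWLAW.json`; B = this file (kernel, every record).
PLACEMENT — KNOWN: double rounding is innocuous when `p' ≥ 2p` AND the exponent range of the wide
format makes the first rounding exact or keeps the product out of the narrow subnormal range
[Figueroa1995, §3], [Roux2014, §4, Table II], [MullerEtAl2018, §3.3.2]; harmful cases come from
midpoints of the narrow format [BoldoMelquiond2008, §2], [Rump2016IEEETC].  We found no statement
deciding innocuousness of products by the subnormal-exponent distance `d` below `2P` in print
(searches logged in `FRESHNESS-ENUM.md`, gen22–23: corpus fts+vec, galaxy).  NEW here (modestly):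
the decision `DRMul ↔ ¬hit(P, 2P - d)` on the gap and the uniform three-regime law, record-generic.
No hardware or vendor claims.
-/

namespace Summit.Ventures.CertifiedArithmetic

open Literature.ComputerArithmetic.FloatingPoint
open Literature.ComputerArithmetic.FloatingPoint.Format
open Literature.ComputerArithmetic.FloatingPoint.MiniFloat

/-! ## §1 Soundness of the table: a hit is a slip -/

/-- A HIT IS A SLIP — for EVERY pair of format records: `F_φ ⊆ F_ψ`, `m = m_φ ≥ 1`,
`2m + 1 ≤ m_ψ`, the gap `m + 2 ≤ d ≤ 2m + 1`, `φ` deep (`m + 3 ≤ bias`) and roomy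
(`(2^(m+1) - 1)·2^(bias-4) ≤ M_φ`), and `mulWindowHitAt (m+1) (2m+2-d) u oa ob` with `1 ≤ u ≤ t`,
`oa, ob < 2^(m+1)` `⟹ ¬ DRMul φ ψ`: the window law (`not_drMul_of_window_above/_below`) at the
data `oa` and `ob·2^(bias+m-1-d-u)` quanta (product `oa·ob·2^-u·q'`) and `j = c = K / 2^(d+u)`.
[this packet] -/
theorem not_drMul_of_mulWindowHitAt {φ ψ : Format} (hE : embedsTest φ ψ = true)
    (h1 : 1 ≤ φ.manBits) (hm : 2 * φ.manBits + 1 ≤ ψ.manBits)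
    (hlo : ψ.qexp + (φ.manBits + 2) ≤ φ.qexp) (hhi : φ.qexp ≤ ψ.qexp + (2 * φ.manBits + 1))
    (hdeep : φ.manBits + 3 ≤ φ.bias)
    (hroom : (2 ^ (φ.manBits + 1) - 1) * 2 ^ (φ.bias - 4) ≤ φ.maxScaled)
    {u oa ob : ℕ} (hu : 1 ≤ u) (hut : u ≤ 2 * φ.manBits + 2 - (φ.qexp - ψ.qexp).toNat)
    (hoa : oa < 2 ^ (φ.manBits + 1)) (hob : ob < 2 ^ (φ.manBits + 1))
    (h : mulWindowHitAt (φ.manBits + 1) (2 * φ.manBits + 2 - (φ.qexp - ψ.qexp).toNat) u oa ob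
      = true) : ¬ DRMul φ ψ := by
  have hE' := hE
  simp only [embedsTest, Bool.and_eq_true, decide_eq_true_eq] at hE'
  obtain ⟨⟨hmm, hq⟩, hMM⟩ := hE'
  obtain ⟨d, hd'⟩ : ∃ d, (φ.qexp - ψ.qexp).toNat = d := ⟨_, rfl⟩
  rw [hd'] at hut h hMM
  have hdlo : φ.manBits + 2 ≤ d := by omega
  have hdhi : d ≤ 2 * φ.manBits + 1 := by omega
  obtain ⟨n, hn⟩ : ∃ n, d + u - 1 = n := ⟨_, rfl⟩
  have hn' : 2 * (φ.manBits + 1) - 1 - (2 * φ.manBits + 2 - d) + u = n := by omega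
  -- unpack the hit: `K = oa·ob = 2A + r`, `A = 2^n c`, the window on `(c, r)`
  simp only [mulWindowHitAt] at h
  rw [hn'] at h
  obtain ⟨c, hc⟩ : ∃ c, oa * ob / 2 ^ (n + 1) = c := ⟨_, rfl⟩
  obtain ⟨r, hr⟩ : ∃ r, oa * ob % 2 ^ (n + 1) = r := ⟨_, rfl⟩
  rw [hc, hr] at h
  simp only [Bool.or_eq_true, Bool.and_eq_true, beq_iff_eq, decide_eq_true_eq] at h
  obtain ⟨hK, hrlt⟩ := (Nat.div_mod_unique (a := oa * ob) (b := 2 ^ (n + 1)) (c := r) (d := c)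
    (by positivity)).mp ⟨hc, hr⟩
  have hn2 : 2 ^ (n + 1) = 2 * 2 ^ n := pow_succ' 2 n
  have hu2 : 2 ^ u = 2 * 2 ^ (u - 1) := by rw [← pow_succ']; congr 1; omega
  obtain ⟨A, hA⟩ : ∃ A, 2 ^ n * c = A := ⟨_, rfl⟩
  have hK' : oa * ob = 2 * A + r := by rw [← hK, hn2, ← hA]; ring
  have hmidA : (2 * c + 1) * 2 ^ (d - 1 + u) = 2 * A + 2 ^ n := by
    rw [show d - 1 + u = n by omega, ← hA]; ring
  -- the size of the cell index: `c + 1 ≤ 2^(2m+1-d) ≤ 2^(m-1)`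
  have hpow : 2 ^ (φ.manBits + 1) = 2 * 2 ^ φ.manBits := pow_succ' 2 _
  have hpm1 : 2 ^ (φ.manBits - 1) * 2 = 2 ^ φ.manBits := by rw [← pow_succ]; congr 1; omega
  have hK2 : oa * ob < 2 ^ (2 * φ.manBits + 2) := by
    calc oa * ob < 2 ^ (φ.manBits + 1) * 2 ^ (φ.manBits + 1) :=
          Nat.mul_lt_mul_of_lt_of_le hoa hob.le (by positivity)
      _ = 2 ^ (2 * φ.manBits + 2) := by rw [← pow_add]; congr 1; omega
  have hc1 : c + 1 ≤ 2 ^ (2 * φ.manBits + 1 - d) := by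
    have := div_two_pow_succ_le hK2 hu hdhi
    rwa [show d + u = n + 1 by omega, hc] at this
  have hcm1 : 2 ^ (2 * φ.manBits + 1 - d) ≤ 2 ^ (φ.manBits - 1) :=
    Nat.pow_le_pow_right (by norm_num) (by omega)
  have hcd : (c + 1) * 2 ^ d ≤ 2 ^ (2 * φ.manBits + 1) := by
    calc (c + 1) * 2 ^ d ≤ 2 ^ (2 * φ.manBits + 1 - d) * 2 ^ d := Nat.mul_le_mul_right _ hc1
      _ = 2 ^ (2 * φ.manBits + 1) := by rw [← pow_add]; congr 1; omega
  have h2m : 2 ^ (2 * φ.manBits + 1) < 2 ^ (ψ.manBits + 1) :=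
    Nat.pow_lt_pow_right (by norm_num) (by omega)
  have h2d : 2 ^ d = 2 * 2 ^ (d - 1) := by rw [← pow_succ']; congr 1; omega
  have hmid1 : (2 * c + 1) * 2 ^ (d - 1) + 2 ^ (d - 1) = (c + 1) * 2 ^ d := by rw [h2d]; ring
  have h1d : 1 ≤ 2 ^ (d - 1) := Nat.one_le_two_pow
  -- room: `oa ≤ 2^(m+1) - 1 ≤ M_φ`, `ob·2^β ≤ (2^(m+1) - 1)·2^(bias-4) ≤ M_φ`, `M_φ·2^d ≤ M_ψ`
  have hb4 : 1 ≤ 2 ^ (φ.bias - 4) := Nat.one_le_two_pow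
  have hMφ : 2 ^ (φ.manBits + 1) - 1 ≤ φ.maxScaled :=
    le_trans (Nat.le_mul_of_pos_right _ hb4) hroom
  have hcdM : (c + 1) * 2 ^ d ≤ φ.maxScaled * 2 ^ d := Nat.mul_le_mul_right _ (by omega)
  obtain ⟨β, hβ⟩ : ∃ β, φ.bias + φ.manBits - 1 - d - u = β := ⟨_, rfl⟩
  have hL : φ.qexp = 1 - (φ.bias : ℤ) - φ.manBits := rfl
  have hexp : ((0 + β + u : ℕ) : ℤ) + 2 * φ.qexp = ψ.qexp := by push_cast; omega
  have ha : oa * 2 ^ 0 ≤ φ.maxScaled := by rw [pow_zero, mul_one]; omega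
  have hb : ob * 2 ^ β ≤ φ.maxScaled := le_trans
    (Nat.mul_le_mul (by omega) (Nat.pow_le_pow_right (by norm_num) (by omega))) hroom
  have hjm : c + 1 < 2 ^ (φ.manBits + 1) := by omega
  have hjM : c + 1 ≤ φ.maxScaled := by omega
  have hjψ : 2 * c + 1 < 2 ^ (ψ.manBits + 1) := by
    have : 2 ^ (φ.manBits + 1) ≤ 2 ^ (ψ.manBits + 1) :=
      Nat.pow_le_pow_right (by norm_num) (by omega)
    omega
  rcases h with ⟨⟨hc0, hr1⟩, hr2⟩ | ⟨⟨hc0, hr1⟩, hr2⟩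
  · refine not_drMul_of_window_above (by omega) h1 hoa hob ha hb hexp (Nat.even_iff.mpr hc0) hjm
      hjM hjψ ?_ ?_ ?_ ?_
    · rw [hd']; omega
    · rw [hd', hmidA, hK']; omega
    · rw [hd', hmidA, hK']; omega
    · intro; rw [hd']; exact ⟨by omega, by omega, by omega⟩
  · refine not_drMul_of_window_below (by omega) h1 hoa hob ha hb hexp (Nat.odd_iff.mpr hc0) hjm
      hjM hjψ ?_ ?_ ?_ ?_
    · rw [hd']; omega
    · rw [hd', hmidA, hK']; omega
    · rw [hd', hmidA, hK']; omega
    · intro; rw [hd']; exact ⟨by omega, by omega⟩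

/-- A HIT OF THE TABLE IS A SLIP: same hypotheses, `mulWindowHit (m+1) (2m+2-d) = true`
`⟹ ¬ DRMul φ ψ`. [this packet] -/
theorem not_drMul_of_mulWindowHit {φ ψ : Format} (hE : embedsTest φ ψ = true)
    (h1 : 1 ≤ φ.manBits) (hm : 2 * φ.manBits + 1 ≤ ψ.manBits)
    (hlo : ψ.qexp + (φ.manBits + 2) ≤ φ.qexp) (hhi : φ.qexp ≤ ψ.qexp + (2 * φ.manBits + 1))
    (hdeep : φ.manBits + 3 ≤ φ.bias)
    (hroom : (2 ^ (φ.manBits + 1) - 1) * 2 ^ (φ.bias - 4) ≤ φ.maxScaled)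
    (h : mulWindowHit (φ.manBits + 1) (2 * φ.manBits + 2 - (φ.qexp - ψ.qexp).toNat) = true) :
    ¬ DRMul φ ψ := by
  unfold mulWindowHit at h
  simp only [List.any_eq_true, List.mem_range, Nat.add_sub_cancel] at h
  obtain ⟨v, hv, i, hi, k, hk, hAt⟩ := h
  have hpow : 2 ^ (φ.manBits + 1) = 2 * 2 ^ φ.manBits := pow_succ' 2 _
  exact not_drMul_of_mulWindowHitAt hE h1 hm hlo hhi hdeep hroom (u := v + 1) (by omega)
    (by omega) (by omega) (by omega) hAt

/-! ## §2 The gap decided -/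

/-- THE GAP DECIDED — for EVERY pair of format records: `F_φ ⊆ F_ψ`, `m = m_φ ≥ 1`,
`2m + 1 ≤ m_ψ` (`P_ψ ≥ 2P`), `m + 2 ≤ d = L_φ - L_ψ ≤ 2m + 1` (`t = 2P - d`), `φ` deep and roomy:
`DRMul φ ψ ↔ mulWindowHit P t = false`. [this packet] -/
theorem drMul_iff_mulWindowHit {φ ψ : Format} (hE : embedsTest φ ψ = true)
    (h1 : 1 ≤ φ.manBits) (hm : 2 * φ.manBits + 1 ≤ ψ.manBits)
    (hlo : ψ.qexp + (φ.manBits + 2) ≤ φ.qexp) (hhi : φ.qexp ≤ ψ.qexp + (2 * φ.manBits + 1))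
    (hdeep : φ.manBits + 3 ≤ φ.bias)
    (hroom : (2 ^ (φ.manBits + 1) - 1) * 2 ^ (φ.bias - 4) ≤ φ.maxScaled) :
    DRMul φ ψ ↔ mulWindowHit (φ.manBits + 1) (2 * φ.manBits + 2 - (φ.qexp - ψ.qexp).toNat)
      = false := by
  refine ⟨fun hD => ?_, fun h => drMul_of_mulWindowHit_eq_false hE h1 ?_ hm hlo hhi h⟩
  · by_contra hh
    exact not_drMul_of_mulWindowHit hE h1 hm hlo hhi hdeep hroom (by simpa using hh) hD
  · have hb4 : 1 ≤ 2 ^ (φ.bias - 4) := Nat.one_le_two_pow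
    have hpow : 2 ^ (φ.manBits + 1) = 2 * 2 ^ φ.manBits := pow_succ' 2 _
    exact le_trans (by omega) (le_trans (Nat.le_mul_of_pos_right _ hb4) hroom)

/-! ## §3 The uniform law in `d ≥ 1` as a boolean test -/

/-- THE LAW AS A TEST: `d ≥ 2P`, or (`P + 1 ≤ d` and no hit at `t = 2P - d`). [this packet] -/
def mulLawTest (φ ψ : Format) : Bool :=
  decide (ψ.qexp + (2 * φ.manBits + 2) ≤ φ.qexp) ||
    (decide (ψ.qexp + (φ.manBits + 2) ≤ φ.qexp) &&
      !mulWindowHit (φ.manBits + 1) (2 * φ.manBits + 2 - (φ.qexp - ψ.qexp).toNat))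

/-- THE HYPOTHESIS OF THE LAW AS A TEST: `F_φ ⊆ F_ψ`, `m ≥ 1`, `2m + 1 ≤ m_ψ`, `d ≥ 1`, deep,
roomy. [this packet] -/
def mulLawHyp (φ ψ : Format) : Bool :=
  embedsTest φ ψ && decide (1 ≤ φ.manBits) && decide (2 * φ.manBits + 1 ≤ ψ.manBits) &&
    decide (ψ.qexp + 1 ≤ φ.qexp) && decide (φ.manBits + 3 ≤ φ.bias) &&
    decide ((2 ^ (φ.manBits + 1) - 1) * 2 ^ (φ.bias - 4) ≤ φ.maxScaled)

/-- ROOM FOR N-mul-U: `(2^m + 1)·2^(bias-m-3) ≤ (2^(m+1) - 1)·2^(bias-4)` (`m ≥ 1`, `bias ≥ m+3`).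
[folklore] -/
theorem succ_pow_mul_le_room {m bias : ℕ} (h1 : 1 ≤ m) (hdeep : m + 3 ≤ bias) :
    (2 ^ m + 1) * 2 ^ (bias - m - 3) ≤ (2 ^ (m + 1) - 1) * 2 ^ (bias - 4) := by
  obtain ⟨a, rfl⟩ : ∃ a, m = a + 1 := ⟨m - 1, by omega⟩
  rw [show bias - 4 = a + (bias - (a + 1) - 3) by omega, pow_add 2 a (bias - (a + 1) - 3),
    ← mul_assoc]
  refine Nat.mul_le_mul_right _ ?_
  have hA : 1 ≤ 2 ^ a := Nat.one_le_two_pow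
  have h2 : 2 ^ (a + 1) = 2 * 2 ^ a := pow_succ' 2 a
  have h4 : 2 ^ (a + 1 + 1) = 2 * (2 * 2 ^ a) := by rw [pow_succ' 2 (a + 1), h2]
  rw [h4, h2]
  calc 2 * 2 ^ a + 1 ≤ (2 * (2 * 2 ^ a) - 1) * 1 := by omega
    _ ≤ (2 * (2 * 2 ^ a) - 1) * 2 ^ a := Nat.mul_le_mul_left _ hA

/-- THE UNIFORM LAW — for EVERY pair of format records with `F_φ ⊆ F_ψ`, `m = m_φ ≥ 1`,
`2m + 1 ≤ m_ψ`, `d = L_φ - L_ψ ≥ 1`, `φ` deep (`m + 3 ≤ bias`) and roomy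
(`(2^(m+1) - 1)·2^(bias-4) ≤ M_φ`): `DRMul φ ψ ↔ mulLawTest φ ψ` — clause (U) for `d ≥ 2m + 2`,
the gap decision for `m + 2 ≤ d ≤ 2m + 1`, THEOREM N-mul-U (at `α = 0`, `β = bias - m - 3`) for
`d ≤ m + 1`. [this packet] -/
theorem drMul_iff_mulLawTest {φ ψ : Format} (hE : embedsTest φ ψ = true) (h1 : 1 ≤ φ.manBits)
    (hm : 2 * φ.manBits + 1 ≤ ψ.manBits) (hd : ψ.qexp + 1 ≤ φ.qexp)
    (hdeep : φ.manBits + 3 ≤ φ.bias)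
    (hroom : (2 ^ (φ.manBits + 1) - 1) * 2 ^ (φ.bias - 4) ≤ φ.maxScaled) :
    DRMul φ ψ ↔ mulLawTest φ ψ = true := by
  by_cases hU : ψ.qexp + (2 * φ.manBits + 2) ≤ φ.qexp
  · have hD : DRMul φ ψ := drMul_of_underflow_of_embedsTest hE h1 hm (by omega)
    simp [mulLawTest, hU, hD]
  by_cases hG : ψ.qexp + (φ.manBits + 2) ≤ φ.qexp
  · rw [drMul_iff_mulWindowHit hE h1 hm hG (by omega) hdeep hroom]
    simp [mulLawTest, hU, hG]
  · have hE' := hE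
    simp only [embedsTest, Bool.and_eq_true, decide_eq_true_eq] at hE'
    obtain ⟨⟨-, hq⟩, hMM⟩ := hE'
    have hb4 : 1 ≤ 2 ^ (φ.bias - 4) := Nat.one_le_two_pow
    have hMφ : 2 ^ (φ.manBits + 1) - 1 ≤ φ.maxScaled :=
      le_trans (Nat.le_mul_of_pos_right _ hb4) hroom
    have hpow : 2 ^ (φ.manBits + 1) = 2 * 2 ^ φ.manBits := pow_succ' 2 _
    have h2m1 : 1 ≤ 2 ^ φ.manBits := Nat.one_le_two_pow
    have hM0 : 0 < φ.maxScaled := by omega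
    have hy : 2 ^ ((φ.qexp - ψ.qexp).toNat - 1) ≤ ψ.maxScaled :=
      le_trans (Nat.pow_le_pow_right (by norm_num) (Nat.sub_le _ 1))
        (le_trans (Nat.le_mul_of_pos_left _ hM0) hMM)
    have hD : ¬ DRMul φ ψ := not_drMul_of_underflow hd (by omega) h1 (α := 0)
      (β := φ.bias - φ.manBits - 3) (by omega) (by rw [pow_zero, mul_one]; exact hMφ)
      (le_trans (succ_pow_mul_le_room h1 hdeep) hroom) hy
    simp [mulLawTest, hU, hG, hD]

/-- THE LAW UNDER THE BOOLEAN HYPOTHESIS: `mulLawHyp φ ψ ⟹ (DRMul φ ψ ↔ mulLawTest φ ψ)`.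
[this packet] -/
theorem drMul_iff_of_mulLawHyp {φ ψ : Format} (h : mulLawHyp φ ψ = true) :
    DRMul φ ψ ↔ mulLawTest φ ψ = true := by
  simp only [mulLawHyp, Bool.and_eq_true, decide_eq_true_eq] at h
  obtain ⟨⟨⟨⟨⟨hE, h1⟩, hm⟩, hd⟩, hdeep⟩, hroom⟩ := h
  exact drMul_iff_mulLawTest hE h1 hm hd hdeep hroom

/-! ## §4 Instances: the exhaustive cells re-derived, cells beyond exhaustion, the named matrix -/

/-- THE CELLS OF `DoubleRoundingProductWindow.lean` BY THE LAW (there: exhaustion of `|F_φ|²`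
products / explicit window data; here: the `P ≤ 4` tables): `t*(2) = 1`, `t*(3) = 3 = P`
(no hit in the gap), `t*(4) = 2`. [this packet] -/
theorem window_cells_by_law : (DRMul X2 Y20 ∧ ¬ DRMul X2 Y21) ∧
    (DRMul X3 Y31 ∧ DRMul X3 Y32 ∧ ¬ DRMul X3 Y33) ∧ (DRMul X4 Y41 ∧ ¬ DRMul X4 Y42) := by
  refine ⟨⟨?_, fun h => absurd ((drMul_iff_of_mulLawHyp (by decide +kernel)).1 h) ?_⟩,
    ⟨?_, ?_, fun h => absurd ((drMul_iff_of_mulLawHyp (by decide +kernel)).1 h) ?_⟩,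
    ⟨?_, fun h => absurd ((drMul_iff_of_mulLawHyp (by decide +kernel)).1 h) ?_⟩⟩
  all_goals first
    | exact (drMul_iff_of_mulLawHyp (by decide +kernel)).2 (by decide +kernel)
    | decide +kernel

/-- `P = 7` pseudo-records: `φ = (m 6, bias 9, emaxCode 8, topMan 63)` (`L_φ = -14`) and registers
of precision `14` at `d = 10` (`t = 4 = t*(7)`) and `d = 11` (`t = 3`). -/
def F7 : Format := ⟨6, 9, 8, 63, by decide⟩
/-- Register `P = 14`, `L = -24` (`d = 10`). -/
def R7d10 : Format := ⟨13, 12, 11, 8191, by decide⟩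
/-- Register `P = 14`, `L = -25` (`d = 11`). -/
def R7d11 : Format := ⟨13, 13, 12, 8191, by decide⟩
/-- `P = 8` pseudo-records (the bfloat16 precision): `φ = (m 7, bias 10, emaxCode 7, topMan 127)`
(`L_φ = -16`) and registers of precision `16` at `d = 14` (`t = 2 = t*(8)`) and `d = 15`. -/
def F8 : Format := ⟨7, 10, 7, 127, by decide⟩
/-- Register `P = 16`, `L = -30` (`d = 14`). -/
def R8d14 : Format := ⟨15, 16, 13, 32767, by decide⟩
/-- Register `P = 16`, `L = -31` (`d = 15`). -/
def R8d15 : Format := ⟨15, 17, 14, 32767, by decide⟩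

set_option maxHeartbeats 4000000 in
/-- BEYOND EXHAUSTION (`|F_φ|² ≈ 2^20.5`, `2^22` products; decided by `≤ 4·4^6`, `2·4^7` table
entries): at `P = 7` the products are innocuous through `d = 11 = 2P - 3` extra binades and slip
through `d = 10` (`t*(7) = 4`); at `P = 8` innocuous through `d = 15 = 2P - 1`, slip through
`d = 14` (`t*(8) = 2`: `113·145 = 2^14 + 2^7 + 2^0 …`). [this packet] -/
theorem law_cells_P7_P8 :
    (¬ DRMul F7 R7d10 ∧ DRMul F7 R7d11) ∧ (¬ DRMul F8 R8d14 ∧ DRMul F8 R8d15) := by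
  refine ⟨⟨fun h => absurd ((drMul_iff_of_mulLawHyp (by decide +kernel)).1 h) ?_, ?_⟩,
    ⟨fun h => absurd ((drMul_iff_of_mulLawHyp (by decide +kernel)).1 h) ?_, ?_⟩⟩
  all_goals first
    | exact (drMul_iff_of_mulLawHyp (by decide +kernel)).2 (by decide +kernel)
    | decide +kernel

/-- ON THE NAMED `13 × 13` MATRIX the law's hypothesis holds on exactly these `20` (source,
register) pairs — the deep sources e4m3, e5m2, binary8p3/p4 in both signednesses, binary16 and
bfloat16 into every named register at least twice as precise —, and every one of them sits in
clause (U) (`d ≥ 2P`; the tightest is bfloat16 → binary32 with `d = 16 = 2P`: by §4's `P = 8`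
cells one binade less of register would still be innocuous, two would not), hence is innocuous;
the shallow sources e2m1, e3m2, e2m3, binary8p5 (`bias < m + 3`) and binary32 (no named register)
are outside the law's scope. [this packet] -/
theorem mulLaw_named :
    (∀ X ∈ namedFormats, ∀ Y ∈ namedFormats, mulLawHyp X Y = true ↔ (X, Y) ∈
      [(E4M3, Binary16), (E4M3, BFloat16), (E4M3, Binary32), (E5M2, Binary16), (E5M2, BFloat16),
        (E5M2, Binary32), (Binary8p3, Binary16), (Binary8p3, BFloat16), (Binary8p3, Binary32),
        (Binary8p4, Binary16), (Binary8p4, BFloat16), (Binary8p4, Binary32),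
        (Binary8p3F, Binary16), (Binary8p3F, BFloat16), (Binary8p3F, Binary32),
        (Binary8p4F, Binary16), (Binary8p4F, BFloat16), (Binary8p4F, Binary32),
        (Binary16, Binary32), (BFloat16, Binary32)]) ∧
    (∀ X ∈ namedFormats, ∀ Y ∈ namedFormats, mulLawHyp X Y = true →
      Y.qexp + (2 * X.manBits + 2) ≤ X.qexp ∧ DRMul X Y) := by
  have hU : ∀ X ∈ namedFormats, ∀ Y ∈ namedFormats, mulLawHyp X Y = true →
      mulLawTest X Y = true ∧ Y.qexp + (2 * X.manBits + 2) ≤ X.qexp := by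
    decide +kernel
  exact ⟨by decide +kernel, fun X hX Y hY h =>
    ⟨(hU X hX Y hY h).2, (drMul_iff_of_mulLawHyp h).2 (hU X hX Y hY h).1⟩⟩

end Summit.Ventures.CertifiedArithmetic
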